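import Summits.QuantumFields.YangMills.Theorems.IR.SmallFieldCoderS2Nesting

/-!
# S₂∕C3 (2/4): measurability of the block field, the exact law of the two-level composite `M ← tM`, laws of the two inputs

Landed for item `stmt-QuantumFields-19354` (`--supports … --as helper`) by the LEAD prover ab-p1 (director-ym №14 (3) landing lane; ideator's OFFER
2026-08-28T05:58:49Z); authored by ideator ym-ir-idea-4 g4, split of the sorry-free workfile `Cruxes/IR/Lines/smallfield_polymer_coder_S2.lean` rev 2
(94b95b4dc241) per `Cruxes/IR/Lines/smallfield_polymer_coder_S2_LANDING.md` v2 (four files `SmallFieldCoderS2{Nesting,LawStep,Locality,Iterate}`).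

Content (§S2.2–§S2.3): `measurable_blockField`, `condLaw_step` (exact law identity of the two-level conditional composition on disjoint noise halves),
`law_lowerInput`, `law_upperInput`.

HONESTY: plumbing only (measure theory ∕ arithmetic over `Theorems/IR/TelescopedCoding*`) — nothing here bears on the Clay Yang–Mills mass gap, a lattice gap or `BalabanLadder.IR`; R4 of the ladder closes only the conditional finite-𝕋⁴ rung `BalabanLadder.UV`.
-/

set_option autoImplicit false

noncomputable section

open MeasureTheory
open Literature.MathematicalPhysics.QuantumFieldTheory Literature.MathematicalPhysics.QuantumLattice
open Summit.QuantumFields.YangMills.Cruxes.IR.TelescopedCoding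

namespace Summit.QuantumFields.YangMills.Cruxes.IR.SmallFieldPolymerCoder

/-! ## §S2.2 Measurability of the block field; the law identity of a two-level conditional composition -/

section LawStep

variable {G : Type} [Group G] [TopologicalSpace G] [IsTopologicalGroup G] [CompactSpace G]
  [MeasurableSpace G] [BorelSpace G] [SecondCountableTopology G]

omit [CompactSpace G] in
/-- The block-holonomy field is measurable (finite products of evaluations; `G` second countable). -/
theorem measurable_blockField (M N : ℕ) : Measurable (blockField (G := G) M N) := by
  refine measurable_pi_lambda _ fun q => ?_
  have h : (fun U : GaugeConfig 4 N G => blockField M N U q) = fun U =>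
      ((((List.range M).filter fun j => blockBase M N q q.2 + j < N).map fun (j : ℕ) (U : GaugeConfig 4 N G) =>
        U (torusEdge N ((fun l => ((blockBase M N q l : ℕ) : ℤ)) + Pi.single q.2 ((j : ℕ) : ℤ), q.2))).map
        fun f => f U).prod := by
    funext U; rw [blockField_apply', List.map_map]; rfl
  rw [h]
  refine List.measurable_fun_prod _ fun f hf => ?_
  obtain ⟨j, -, rfl⟩ := List.mem_map.1 hf
  exact measurable_pi_apply _

variable {N : ℕ} (ρ : G →* Matrix (Fin N) (Fin N) ℂ) (β : ℝ)

/-- **Law step.** If `C` samples the fine field given its `M`-block field and `B` samples the `M`-block field given the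
`2M`-block field (exact conditional samplers driven by independent sequence noises), then
`(V, ω) ↦ C (reblock M (B (V, ω_even)), ω_odd)` samples the fine field given its `2M`-block field.  Pure measure algebra
over the exact nesting `blockField (tM) = nestMul t M ∘ blockField M`. -/
theorem condLaw_step {S M t : ℕ} (hM : 0 < M)
    {C B : GaugeConfig 4 (2 * S + 1) G × Noise G (2 * S + 1) → GaugeConfig 4 (2 * S + 1) G}
    (hC : Measurable C) (hB : Measurable B)
    (hClaw : (((wilsonMeasure (d := 4) (L := 2 * S + 1) ρ β).map (blockField M (2 * S + 1))).prod
        (seqNoise G (2 * S + 1))).map (fun p => (p.1, C p)) =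
      (wilsonMeasure (d := 4) (L := 2 * S + 1) ρ β).map (fun U => (blockField M (2 * S + 1) U, U)))
    (hBlaw : (((wilsonMeasure (d := 4) (L := 2 * S + 1) ρ β).map (blockField (t * M) (2 * S + 1))).prod
        (seqNoise G (2 * S + 1))).map (fun p => (p.1, B p)) =
      (wilsonMeasure (d := 4) (L := 2 * S + 1) ρ β).map
        (fun U => (blockField (t * M) (2 * S + 1) U, blockField M (2 * S + 1) U))) :
    (((wilsonMeasure (d := 4) (L := 2 * S + 1) ρ β).map (blockField (t * M) (2 * S + 1))).prod
        (seqNoise G (2 * S + 1))).map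
        (fun p => (p.1, C (reblock M (2 * S + 1) (B (p.1, evenPart p.2)), oddPart p.2))) =
      (wilsonMeasure (d := 4) (L := 2 * S + 1) ρ β).map (fun U => (blockField (t * M) (2 * S + 1) U, U)) := by
  haveI : IsProbabilityMeasure (seqNoise G (2 * S + 1)) := isProbabilityMeasure_seqNoise _
  haveI : SFinite (wilsonMeasure (d := 4) (L := 2 * S + 1) ρ β) := by
    unfold wilsonMeasure wilsonWeight; infer_instance
  -- names
  set μ : Measure (GaugeConfig 4 (2 * S + 1) G) := wilsonMeasure (d := 4) (L := 2 * S + 1) ρ β with hμ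
  set ν : Measure (Noise G (2 * S + 1)) := seqNoise G (2 * S + 1) with hν
  have hbf : ∀ M', Measurable (blockField (G := G) M' (2 * S + 1)) := fun M' => measurable_blockField M' _
  have hrb : Measurable (reblock (G := G) M (2 * S + 1)) := measurable_reblock _ _
  have hn2 : Measurable (nestMul (G := G) t M (2 * S + 1)) := measurable_nestMul _ _ _
  -- the three maps
  set g : GaugeConfig 4 (2 * S + 1) G × Noise G (2 * S + 1) → GaugeConfig 4 (2 * S + 1) G × GaugeConfig 4 (2 * S + 1) G :=
    fun p => (p.1, reblock M (2 * S + 1) (B p)) with hg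
  have hgm : Measurable g := measurable_fst.prodMk (hrb.comp hB)
  set F : GaugeConfig 4 (2 * S + 1) G × Noise G (2 * S + 1) →
      (GaugeConfig 4 (2 * S + 1) G × GaugeConfig 4 (2 * S + 1) G) × Noise G (2 * S + 1) :=
    fun p => ((p.1, reblock M (2 * S + 1) (B (p.1, evenPart p.2))), oddPart p.2) with hF
  set H : (GaugeConfig 4 (2 * S + 1) G × GaugeConfig 4 (2 * S + 1) G) × Noise G (2 * S + 1) →
      GaugeConfig 4 (2 * S + 1) G × GaugeConfig 4 (2 * S + 1) G := fun r => (r.1.1, C (r.1.2, r.2)) with hH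
  have hHm : Measurable H := (measurable_fst.comp measurable_fst).prodMk
    (hC.comp ((measurable_snd.comp measurable_fst).prodMk measurable_snd))
  have hFeq : F = ((Prod.map g id) ∘ ⇑(MeasurableEquiv.prodAssoc.symm)) ∘ (Prod.map id splitNoise) := by
    funext p; rfl
  have hFm : Measurable F := by
    rw [hFeq]
    exact (hgm.prodMap measurable_id).comp
      ((MeasurableEquiv.prodAssoc.symm).measurable.comp (measurable_id.prodMap measurable_splitNoise))
  have htarget : (fun p : GaugeConfig 4 (2 * S + 1) G × Noise G (2 * S + 1) =>
      (p.1, C (reblock M (2 * S + 1) (B (p.1, evenPart p.2)), oddPart p.2))) = H ∘ F := by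
    funext p; rfl
  -- Claim 1: the law of `F`
  have hτ : (((μ.map (blockField (t * M) (2 * S + 1))).prod ν).map g) =
      μ.map (fun U => (blockField (t * M) (2 * S + 1) U, blockField M (2 * S + 1) U)) := by
    have hg' : g = (Prod.map id (reblock M (2 * S + 1))) ∘ (fun p => (p.1, B p)) := by funext p; rfl
    rw [hg', ← Measure.map_map (measurable_id.prodMap hrb) (measurable_fst.prodMk hB), hBlaw,
      Measure.map_map (measurable_id.prodMap hrb) ((hbf _).prodMk (hbf _))]
    have hfun : (Prod.map id (reblock M (2 * S + 1))) ∘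
        (fun U : GaugeConfig 4 (2 * S + 1) G => (blockField (t * M) (2 * S + 1) U, blockField M (2 * S + 1) U)) =
        fun U => (blockField (t * M) (2 * S + 1) U, blockField M (2 * S + 1) U) := by
      funext U; simp only [Function.comp, Prod.map, id, reblock_blockField hM]
    rw [hfun]
  have h1 : ((μ.map (blockField (t * M) (2 * S + 1))).prod ν).map F =
      (μ.map (fun U => (blockField (t * M) (2 * S + 1) U, blockField M (2 * S + 1) U))).prod ν := by
    rw [hFeq, ← Measure.map_map ((hgm.prodMap measurable_id).comp (MeasurableEquiv.prodAssoc.symm).measurable)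
      (measurable_id.prodMap measurable_splitNoise)]
    rw [← Measure.map_prod_map _ _ measurable_id measurable_splitNoise, Measure.map_id, seqNoise_map_splitNoise]
    rw [← Measure.map_map (hgm.prodMap measurable_id) (MeasurableEquiv.prodAssoc.symm).measurable]
    rw [((MeasureTheory.measurePreserving_prodAssoc (μ.map (blockField (t * M) (2 * S + 1))) ν ν).symm
      MeasurableEquiv.prodAssoc).map_eq]
    rw [← Measure.map_prod_map _ _ hgm measurable_id, Measure.map_id, hτ]
  -- Claim 2: `τ ⊗ ν` from the `M`-level pair law via nesting
  have hnm : Measurable (fun W : GaugeConfig 4 (2 * S + 1) G => (nestMul t M (2 * S + 1) W, W)) :=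
    hn2.prodMk measurable_id'
  have h2 : (μ.map (fun U => (blockField (t * M) (2 * S + 1) U, blockField M (2 * S + 1) U))).prod ν =
      ((μ.map (blockField M (2 * S + 1))).prod ν).map
        (Prod.map (fun W => (nestMul t M (2 * S + 1) W, W)) id) := by
    rw [← Measure.map_prod_map _ _ hnm measurable_id, Measure.map_id, Measure.map_map hnm (hbf M)]
    have hfun : ((fun W : GaugeConfig 4 (2 * S + 1) G => (nestMul t M (2 * S + 1) W, W)) ∘ blockField M (2 * S + 1)) =
        fun U => (blockField (t * M) (2 * S + 1) U, blockField M (2 * S + 1) U) := by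
      funext U; simp only [Function.comp, blockField_mul (t := t) hM]
    rw [hfun]
  -- assemble
  rw [htarget, ← Measure.map_map hHm hFm, h1, h2, Measure.map_map hHm (hnm.prodMap measurable_id)]
  have hHF : H ∘ Prod.map (fun W => (nestMul t M (2 * S + 1) W, W)) id =
      (Prod.map (nestMul t M (2 * S + 1)) id) ∘ (fun p => (p.1, C p)) := by
    funext p; rfl
  rw [hHF, ← Measure.map_map (hn2.prodMap measurable_id) (measurable_fst.prodMk hC), hClaw,
    Measure.map_map (hn2.prodMap measurable_id) ((hbf M).prodMk measurable_id')]
  have hfun : (Prod.map (nestMul t M (2 * S + 1)) id) ∘ (fun U : GaugeConfig 4 (2 * S + 1) G => (blockField M (2 * S + 1) U, U)) =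
      fun U => (blockField (t * M) (2 * S + 1) U, U) := by
    funext U; simp only [Function.comp, Prod.map, id, blockField_mul (t := t) hM]
  rw [hfun]

end LawStep

/-! ## §S2.3 Laws of the two inputs of the composite; locality predicates; the graded locality step -/

section LocStep

variable {G : Type} [Group G] [TopologicalSpace G] [IsTopologicalGroup G] [CompactSpace G]
  [MeasurableSpace G] [BorelSpace G] [SecondCountableTopology G]

variable {N : ℕ} (ρ : G →* Matrix (Fin N) (Fin N) ℂ) (β : ℝ)

/-- **Law of the lower stage's input.** Under `(blockField 2M)_* μ ⊗ ν`, the pair `(reblock M (B (V, ω_even)), ω_odd)` has law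
`(blockField M)_* μ ⊗ ν` whenever `B` samples the `M`-block field given the `2M`-block field. -/
theorem law_lowerInput {S M t : ℕ} (hM : 0 < M)
    {B : GaugeConfig 4 (2 * S + 1) G × Noise G (2 * S + 1) → GaugeConfig 4 (2 * S + 1) G} (hB : Measurable B)
    (hBlaw : (((wilsonMeasure (d := 4) (L := 2 * S + 1) ρ β).map (blockField (t * M) (2 * S + 1))).prod
        (seqNoise G (2 * S + 1))).map (fun p => (p.1, B p)) =
      (wilsonMeasure (d := 4) (L := 2 * S + 1) ρ β).map
        (fun U => (blockField (t * M) (2 * S + 1) U, blockField M (2 * S + 1) U))) :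
    (((wilsonMeasure (d := 4) (L := 2 * S + 1) ρ β).map (blockField (t * M) (2 * S + 1))).prod
        (seqNoise G (2 * S + 1))).map (fun p => (reblock M (2 * S + 1) (B (p.1, evenPart p.2)), oddPart p.2)) =
      ((wilsonMeasure (d := 4) (L := 2 * S + 1) ρ β).map (blockField M (2 * S + 1))).prod (seqNoise G (2 * S + 1)) := by
  haveI : IsProbabilityMeasure (seqNoise G (2 * S + 1)) := isProbabilityMeasure_seqNoise _
  haveI : SFinite (wilsonMeasure (d := 4) (L := 2 * S + 1) ρ β) := by
    unfold wilsonMeasure wilsonWeight; infer_instance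
  set μ : Measure (GaugeConfig 4 (2 * S + 1) G) := wilsonMeasure (d := 4) (L := 2 * S + 1) ρ β with hμ
  set ν : Measure (Noise G (2 * S + 1)) := seqNoise G (2 * S + 1) with hν
  have hbf : ∀ M', Measurable (blockField (G := G) M' (2 * S + 1)) := fun M' => measurable_blockField M' _
  have hrb : Measurable (reblock (G := G) M (2 * S + 1)) := measurable_reblock _ _
  set g : GaugeConfig 4 (2 * S + 1) G × Noise G (2 * S + 1) → GaugeConfig 4 (2 * S + 1) G :=
    fun p => reblock M (2 * S + 1) (B p) with hg
  have hgm : Measurable g := hrb.comp hB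
  have hFeq : (fun p : GaugeConfig 4 (2 * S + 1) G × Noise G (2 * S + 1) =>
      (reblock M (2 * S + 1) (B (p.1, evenPart p.2)), oddPart p.2)) =
      ((Prod.map g id) ∘ ⇑(MeasurableEquiv.prodAssoc.symm)) ∘ (Prod.map id splitNoise) := by
    funext p; rfl
  have hτ : ((μ.map (blockField (t * M) (2 * S + 1))).prod ν).map g = μ.map (blockField M (2 * S + 1)) := by
    have hg' : g = (fun r : GaugeConfig 4 (2 * S + 1) G × GaugeConfig 4 (2 * S + 1) G => reblock M (2 * S + 1) r.2) ∘
        (fun p => (p.1, B p)) := by funext p; rfl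
    have hrs : Measurable (fun r : GaugeConfig 4 (2 * S + 1) G × GaugeConfig 4 (2 * S + 1) G => reblock M (2 * S + 1) r.2) :=
      hrb.comp measurable_snd
    rw [hg', ← Measure.map_map hrs (measurable_fst.prodMk hB), hBlaw, Measure.map_map hrs ((hbf _).prodMk (hbf _))]
    have hfun : ((fun r : GaugeConfig 4 (2 * S + 1) G × GaugeConfig 4 (2 * S + 1) G => reblock M (2 * S + 1) r.2) ∘
        (fun U : GaugeConfig 4 (2 * S + 1) G => (blockField (t * M) (2 * S + 1) U, blockField M (2 * S + 1) U))) =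
        blockField M (2 * S + 1) := by
      funext U; simp only [Function.comp, reblock_blockField hM]
    rw [hfun]
  rw [hFeq, ← Measure.map_map ((hgm.prodMap measurable_id).comp (MeasurableEquiv.prodAssoc.symm).measurable)
    (measurable_id.prodMap measurable_splitNoise)]
  rw [← Measure.map_prod_map _ _ measurable_id measurable_splitNoise, Measure.map_id, seqNoise_map_splitNoise]
  rw [← Measure.map_map (hgm.prodMap measurable_id) (MeasurableEquiv.prodAssoc.symm).measurable]
  rw [((MeasureTheory.measurePreserving_prodAssoc (μ.map (blockField (t * M) (2 * S + 1))) ν ν).symm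
    MeasurableEquiv.prodAssoc).map_eq]
  rw [← Measure.map_prod_map _ _ hgm measurable_id, Measure.map_id, hτ]

/-- **Law of the upper stage's input**: `(V, ω_even)` has the law of `(V, ω)`. -/
theorem law_upperInput {S M : ℕ} :
    (((wilsonMeasure (d := 4) (L := 2 * S + 1) ρ β).map (blockField M (2 * S + 1))).prod
        (seqNoise G (2 * S + 1))).map (fun p => (p.1, evenPart p.2)) =
      ((wilsonMeasure (d := 4) (L := 2 * S + 1) ρ β).map (blockField M (2 * S + 1))).prod (seqNoise G (2 * S + 1)) := by
  haveI : IsProbabilityMeasure (seqNoise G (2 * S + 1)) := isProbabilityMeasure_seqNoise _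
  haveI : SFinite (wilsonMeasure (d := 4) (L := 2 * S + 1) ρ β) := by
    unfold wilsonMeasure wilsonWeight; infer_instance
  have h : (fun p : GaugeConfig 4 (2 * S + 1) G × Noise G (2 * S + 1) => (p.1, evenPart p.2)) = Prod.map id evenPart := by
    funext p; rfl
  rw [h, ← Measure.map_prod_map _ _ measurable_id measurable_evenPart, Measure.map_id, seqNoise_map_evenPart]

end LocStep

end Summit.QuantumFields.YangMills.Cruxes.IR.SmallFieldPolymerCoder

end
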